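import Summits.Parity.GeneralizedHardyLittlewood.Theorems.GreenTaoLevelTwoGITwoCyclicInverseGeneratorLinear
import Mathlib.Analysis.SpecialFunctions.Complex.CircleAddChar
import Mathlib.LinearAlgebra.Matrix.NonsingularInverse

/-!
# Route `GreenTaoLevelTwo`, crux `GITwo` (stmt-Parity-21275), line `birth`, stub `stub_cyclicInverse`:
# the phase `M(x)·x` is a bracket quadratic on a small Bohr set (GT08a arXiv Prop. 54)

Fifty-ninth helper file toward the XL stub `stub_cyclicInverse` (B. Green, T. Tao, *An inverse
theorem for the Gowers `U³(G)` norm*, arXiv:math/0503014, Thm. 68 = PEMS 51 (2008) Thm. 12.8).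
Block D15 (arXiv §10, Prop. 54: "From Corollary (prog-large) we know that the `Φ(vⱼ)` are linearly
independent. Thus there exists a vector `uᵢ ∈ ℝ^S` such that `Φ(l₁v₁ + … + l_d v_d) · uᵢ = lᵢ` …
`lᵢ = ∑_{ξ∈S} u_{iξ} {ξ · x}`. Inserting this formula … we obtain the claim."), for the explicit
locally quadratic phase `x ↦ M(x)·x/N` delivered by §9 (`M` additive on a Bohr set `B(ξ,ρ₀)`):
with the generators `vⱼ, wⱼ` of `…BohrLattice`, the dual vectors `a_{j·}` of the `wⱼ`
(`exists_dual_coeffs`), the nearest lifts `m_l(x) = N{ξ_l x/N} = valMinAbs (x ξ_l)` and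
`k_j(x) = N{η_j x/N}`, `η_j = M(v_j)`, one has on `B(ξ,ρ)`, `ρ · 2^{d(d+2)} d² < ρ₀`:
`e(M(x)x/N) = ∏_{j,l} e(a_{jl} m_l(x) k_j(x) / N)` — a product of `d²` bracket quadratic monomials
`e(a'_{jl} {ξ_l x/N}{η_j x/N})`, `a'_{jl} = N a_{jl}` (arXiv (phi-expand)).

* `exists_dual_coeffs` — dual coefficients of an `ℝ`-independent integer family;
* `abs_apply_le_norm` — `|w_{jl}| ≤ ‖wⱼ‖`;
* `stdAddChar_sum_coords_mul_eq` — `e((∑ cⱼ ηⱼ)·x/N) = ∏ⱼ e(cⱼ k_j(x)/N)`;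
* `stdAddChar_mul_self_eq_prod_bracket` — the factorisation above (arXiv Prop. 54 for `M(x)·x`).

References: [GreenTao2008U3Inverse] arXiv:math/0503014, §10, Prop. 54 and (phi-expand) in §12.
-/

noncomputable section

namespace Summit.Parity.GeneralizedHardyLittlewood.GreenTaoLevelTwoGITwoCyclicInverse

open Finset Literature.Algebra.EuclideanLattices

/-- **Dual coefficients.**  If `w₀,…,w_{d−1} ∈ ℤᵈ` are linearly independent over `ℝ`, there is a
real matrix `a` with `u_j = ∑_l a_{jl} (∑_i u_i w_{il})` for every real `u` (the columns of
`W⁻¹`). [cite: GreenTao2008U3Inverse, §10 (proof of Prop. 54, the vectors `uᵢ`)] -/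
theorem exists_dual_coeffs {d : ℕ} (w : Fin d → Fin d → ℤ)
    (hli : LinearIndependent ℝ (⇑(intVecToEuclidean d) ∘ w)) :
    ∃ a : Fin d → Fin d → ℝ, ∀ (u : Fin d → ℝ) (j : Fin d),
      u j = ∑ l, a j l * ∑ i, u i * (w i l : ℝ) := by
  classical
  let I : LatticeInstance := ⟨d, Matrix.of w⟩
  have hns : I.IsNonsingular := (LatticeInstance.isNonsingular_iff_linearIndependent I).2 hli
  have hdet : ((Matrix.of w).map (Int.cast : ℤ → ℝ)).det ≠ 0 :=
    LatticeInstance.det_map_cast_ne_zero hns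
  set W : Matrix (Fin d) (Fin d) ℝ := (Matrix.of w).map (Int.cast : ℤ → ℝ) with hW
  have hunit : IsUnit W.det := isUnit_iff_ne_zero.2 hdet
  have hmul : W * W⁻¹ = 1 := Matrix.mul_nonsing_inv W hunit
  refine ⟨fun j l => W⁻¹ l j, fun u j => ?_⟩
  have h1 : u j = ∑ i, u i * (W * W⁻¹) i j := by
    rw [hmul]
    simp [Matrix.one_apply]
  rw [h1]
  have hWil : ∀ i l, W i l = (w i l : ℝ) := fun i l => by simp [hW]
  simp only [Matrix.mul_apply, Finset.mul_sum]
  rw [Finset.sum_comm]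
  refine Finset.sum_congr rfl fun l _ => Finset.sum_congr rfl fun i _ => ?_
  rw [hWil]; ring

/-- A coordinate is bounded by the Euclidean norm: `|w_{jl}| ≤ ‖wⱼ‖`. [folklore] -/
theorem abs_apply_le_norm {d : ℕ} (m : Fin d → ℤ) (l : Fin d) :
    |(m l : ℝ)| ≤ ‖intVecToEuclidean d m‖ := by
  rw [EuclideanSpace.norm_eq]
  refine Real.abs_le_sqrt ?_
  have : ((m l : ℝ)) ^ 2 = ‖(intVecToEuclidean d m) l‖ ^ 2 := by
    rw [intVecToEuclidean_apply, Real.norm_eq_abs, sq_abs]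
  rw [this]
  exact Finset.single_le_sum (f := fun l' => ‖(intVecToEuclidean d m) l'‖ ^ 2)
    (fun _ _ => sq_nonneg _) (Finset.mem_univ l)

/-- `e((∑ⱼ cⱼ ηⱼ)·x / N) = ∏ⱼ e(cⱼ · k_j / N)` with `k_j = valMinAbs (ηⱼ x)` the nearest lift.
[folklore] -/
theorem stdAddChar_sum_coords_mul_eq {N : ℕ} [NeZero N] {d : ℕ} (c : Fin d → ℤ)
    (η : Fin d → ZMod N) (x : ZMod N) :
    (ZMod.stdAddChar ((∑ j, (c j : ZMod N) * η j) * x) : ℂ) =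
      ∏ j, Complex.exp (2 * Real.pi * Complex.I * ((c j : ℝ) * ((η j * x).valMinAbs : ℝ) / N)) := by
  have h1 : (∑ j, (c j : ZMod N) * η j) * x =
      (((∑ j, c j * (η j * x).valMinAbs : ℤ)) : ZMod N) := by
    rw [Int.cast_sum, Finset.sum_mul]
    refine Finset.sum_congr rfl fun j _ => ?_
    rw [Int.cast_mul, ZMod.coe_valMinAbs, mul_assoc]
  rw [h1, ZMod.stdAddChar_coe, ← Complex.exp_sum]
  congr 1
  push_cast
  rw [Finset.mul_sum, Finset.sum_div]
  refine Finset.sum_congr rfl fun j _ => ?_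
  ring

/-- **The phase `M(x)·x` is a bracket quadratic on a small Bohr set (GT08a arXiv Prop. 54 for the
explicit phase of §9).**  Let `N` be prime, `ξ : Fin d → ℤ/Nℤ` with `ξ l₀ ≠ 0`, `wⱼ ≡ vⱼ ξ`
generators with the coordinate property of `exists_bohr_lattice_generators`, `a` dual
coefficients of the `wⱼ` (`exists_dual_coeffs`), and `μ` additive on `B(ξ,ρ₀)` (`ρ₀ > 0`).  If
`ρ · (2^{d(d+2)} d²) < ρ₀` then every `x` with `‖x ξ_l/N‖ < ρ` (`∀ l`) has integer coordinates `c`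
with `x = ∑ cⱼ vⱼ`, `μ x = ∑ cⱼ μ(vⱼ)`, `cⱼ = ∑_l a_{jl} valMinAbs(x ξ_l)`, and
`e(μ(x)·x/N) = ∏ⱼ ∏_l e(a_{jl} · valMinAbs(x ξ_l) · valMinAbs(μ(vⱼ) x) / N)`.
[cite: GreenTao2008U3Inverse, §10, Prop. 54] -/
theorem stdAddChar_mul_self_eq_prod_bracket {N : ℕ} [Fact N.Prime] {d : ℕ} (ξ : Fin d → ZMod N)
    (l₀ : Fin d) (hξ : ξ l₀ ≠ 0) {w : Fin d → Fin d → ℤ} {v : Fin d → ZMod N}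
    (hv : ∀ j l, ((w j l : ℤ) : ZMod N) = v j * ξ l)
    (hcoord : ∀ m : Fin d → ℤ, (∃ x : ZMod N, ∀ l, ((m l : ℤ) : ZMod N) = x * ξ l) →
      ∃ c : Fin d → ℤ, m = ∑ j, c j • w j ∧
        ∀ j, |(c j : ℝ)| * ‖intVecToEuclidean d (w j)‖ ≤
          2 ^ (d * (d + 2)) * ‖intVecToEuclidean d m‖)
    {a : Fin d → Fin d → ℝ} (ha : ∀ (u : Fin d → ℝ) (j : Fin d),
      u j = ∑ l, a j l * ∑ i, u i * (w i l : ℝ))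
    {ρ₀ ρ : ℝ} (hρ₀ : 0 < ρ₀) (hρ : ρ * (2 ^ (d * (d + 2)) * d * d) < ρ₀)
    (μ : ZMod N → ZMod N)
    (hadd : ∀ a b : ZMod N, (∀ l, ‖ZMod.toAddCircle (a * ξ l)‖ < ρ₀) →
      (∀ l, ‖ZMod.toAddCircle (b * ξ l)‖ < ρ₀) →
      (∀ l, ‖ZMod.toAddCircle ((a + b) * ξ l)‖ < ρ₀) → μ (a + b) = μ a + μ b)
    {x : ZMod N} (hx : ∀ l, ‖ZMod.toAddCircle (x * ξ l)‖ < ρ) :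
    ∃ c : Fin d → ℤ, x = ∑ j, (c j : ZMod N) * v j ∧
      μ x = ∑ j, (c j : ZMod N) * μ (v j) ∧
      (∀ j, (c j : ℝ) = ∑ l, a j l * ((x * ξ l).valMinAbs : ℝ)) ∧
      (ZMod.stdAddChar (μ x * x) : ℂ) =
        ∏ j, ∏ l, Complex.exp (2 * Real.pi * Complex.I *
          (a j l * ((x * ξ l).valMinAbs : ℝ) * ((μ (v j) * x).valMinAbs : ℝ) / N)) := by
  classical
  haveI : NeZero N := ⟨(Fact.out : N.Prime).ne_zero⟩
  have hNpos : (0 : ℝ) < N := by exact_mod_cast (Fact.out : N.Prime).pos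
  obtain ⟨c, hm, hxc, hb⟩ := exists_coords_of_bohr ξ l₀ hξ hv hcoord hx
  -- the weight bound `∑ⱼ |cⱼ| |w_{jl}| < ρ₀ N`
  have hd1 : (1 : ℝ) ≤ d := by
    have : 0 < d := Fin.pos l₀
    exact_mod_cast this
  have hρpos : 0 < ρ := (norm_nonneg _).trans_lt (hx l₀)
  have hweight : ∀ l, (∑ j, |(c j : ℝ)| * |(w j l : ℝ)|) < ρ₀ * N := by
    intro l
    have h1 : ∀ j, |(c j : ℝ)| * |(w j l : ℝ)| ≤ 2 ^ (d * (d + 2)) * (d * (ρ * N)) := fun j =>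
      (mul_le_mul_of_nonneg_left (abs_apply_le_norm (w j) l) (abs_nonneg _)).trans (hb j)
    calc (∑ j, |(c j : ℝ)| * |(w j l : ℝ)|) ≤ ∑ _j : Fin d, 2 ^ (d * (d + 2)) * (d * (ρ * N)) :=
          Finset.sum_le_sum fun j _ => h1 j
      _ = (ρ * (2 ^ (d * (d + 2)) * d * d)) * N := by
          rw [Finset.sum_const, Finset.card_univ, Fintype.card_fin, nsmul_eq_mul]; ring
      _ < ρ₀ * N := mul_lt_mul_of_pos_right hρ hNpos
  have hlin := map_sum_coords_eq_of_additive ξ hv hρ₀ μ hadd c hweight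
  rw [← hxc] at hlin
  -- the dual formula for the coordinates
  have hdual : ∀ j, (c j : ℝ) = ∑ l, a j l * ((x * ξ l).valMinAbs : ℝ) := by
    intro j
    have h1 := ha (fun i => (c i : ℝ)) j
    rw [h1]
    refine Finset.sum_congr rfl fun l _ => ?_
    congr 1
    have h2 := congrArg (fun m : Fin d → ℤ => (m l : ℝ)) hm
    simp only [Finset.sum_apply, Pi.smul_apply, smul_eq_mul, Int.cast_sum, Int.cast_mul] at h2
    exact h2.symm
  refine ⟨c, hxc, hlin, hdual, ?_⟩
  -- the phase
  have hphase : μ x * x = (∑ j, (c j : ZMod N) * μ (v j)) * x := by rw [← hlin]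
  rw [hphase, stdAddChar_sum_coords_mul_eq]
  refine Finset.prod_congr rfl fun j _ => ?_
  rw [hdual j, ← Complex.exp_sum]
  congr 1
  push_cast
  rw [Finset.sum_mul, Finset.sum_div, Finset.mul_sum]

end Summit.Parity.GeneralizedHardyLittlewood.GreenTaoLevelTwoGITwoCyclicInverse
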